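import Literature.AlgebraicGeometry.Modules.IsZeroOfAffineCover
import HarnessLib

/-!
# A morphism of affine-localizing modules bijective on the members of an affine open cover is an isomorphism

For a scheme `X`, affine-localizing (`Modules/AffineLocalizing`; e.g. quasi-coherent) `𝒪_X`-modules `M`, `N`,
a morphism `φ : M ⟶ N` and an affine open cover `(V_i)` of `X`:

* `surjective_app_basicOpen_of_surjective_app` — if `φ` is surjective on `Γ(V, –)` for an affine open `V`, it is
  surjective on `Γ(D(g), –)` for every `g ∈ Γ(V, 𝒪_X)` (numerators: a section of `N` over `D(g)` is `y|/gⁿ`);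
* `epi_of_app_surjective_of_cover` — `φ` surjective on the `Γ(V_i, –)` ⇒ `φ` is an EPIMORPHISM (the basic opens of
  the `V_i` form a basis, `epi_of_surjective_on_basis`);
* **`isIso_of_app_bijective_of_cover`** — `φ` bijective on the `Γ(V_i, –)` ⇒ `φ` is an ISOMORPHISM (with the tree's
  `mono_of_app_injective_of_cover`; `Mod(𝒪_X)` is balanced).

This is Hartshorne II Cor. 5.5 ∕ Prop. 5.6 («on an affine scheme a quasi-coherent module is determined by its global
sections») in the form used to turn ring-level computations over the pieces of an affine cover into statements
about sheaves. Everything is proved; no named facts.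

## References

* R. Hartshorne, *Algebraic Geometry*, GTM 52 (1977), II Lemma 5.3, Cor. 5.5, Prop. 5.6 (pp. 112–113). [Hartshorne1977]
* The Stacks Project, Tag 01I7. [StacksProject]
-/

noncomputable section

-- `TopCat.Presheaf`/`Scheme.Modules` are not reducible (as in Mathlib's `AlgebraicGeometry/Modules/Sheaf.lean`).
set_option backward.isDefEq.respectTransparency false

open CategoryTheory CategoryTheory.Limits AlgebraicGeometry Opposite TopologicalSpace

universe u

namespace Literature.AlgebraicGeometry.Modules

variable {X : Scheme.{u}} {M N : X.Modules} (φ : M ⟶ N)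

/-- **Surjectivity descends from an affine open to its basic opens**: if `φ_V : Γ(V, M) → Γ(V, N)` is surjective
(`V` affine, `N` affine-localizing) then so is `φ_{D(g)}` for every `g ∈ Γ(V, 𝒪_X)` — a section of `N` over `D(g)`
is `y|_{D(g)} / gⁿ` with `y ∈ Γ(V, N)`. [cite: Hartshorne1977, II Lemma 5.3 (b) (p. 112)] -/
theorem surjective_app_basicOpen_of_surjective_app (hN : IsAffineLocalizing N) {V : X.Opens}
    (hV : IsAffineOpen V) (hsurj : Function.Surjective (φ.app V)) (g : Γ(X, V)) :
    Function.Surjective (φ.app (X.basicOpen g)) := by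
  intro s
  obtain ⟨n, y, hy⟩ := hN.numerator hV g rfl s
  obtain ⟨x, rfl⟩ := hsurj y
  have hu : IsUnit (X.presheaf.map (homOfLE ((rfl : X.basicOpen g = X.basicOpen g).trans_le
      (X.basicOpen_le g))).op g ^ n) :=
    (RingedSpace.isUnit_res_basicOpen (X := X.toRingedSpace) g).pow n
  obtain ⟨v, hv⟩ := hu
  refine ⟨(↑v⁻¹ : Γ(X, X.basicOpen g)) • M.presheaf.map (homOfLE (X.basicOpen_le g)).op x, ?_⟩
  rw [Scheme.Modules.Hom.app_smul, Literature.AlgebraicGeometry.Motives.Scheme.Modules.Hom.app_map_apply]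
  have hy' : N.presheaf.map (homOfLE (X.basicOpen_le g)).op (φ.app V x) = (↑v : Γ(X, X.basicOpen g)) • s := by
    rw [hv]; exact hy
  rw [hy', smul_smul, Units.inv_mul, one_smul]

/-- **Epimorphisms are detected on an affine open cover**: a morphism into an affine-localizing module which is
surjective on the sections over the members of an affine open cover is an epimorphism.
[cite: Hartshorne1977, II Prop. 5.6 (p. 113)] -/
theorem epi_of_app_surjective_of_cover (hN : IsAffineLocalizing N) {ι : Type*} (V : ι → X.Opens)
    (hV : ∀ i, IsAffineOpen (V i)) (hcov : ⨆ i, V i = ⊤) (hsurj : ∀ i, Function.Surjective (φ.app (V i))) :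
    Epi φ := by
  refine epi_of_surjective_on_basis φ (isBasis_basicOpen_of_cover V hV hcov) ?_
  rintro _ ⟨i, g, rfl⟩
  exact surjective_app_basicOpen_of_surjective_app φ hN (hV i) (hsurj i) g

/-- **Isomorphisms are detected on an affine open cover**: a morphism of affine-localizing (e.g. quasi-coherent)
modules which is bijective on the sections over the members of an affine open cover is an isomorphism.
[cite: Hartshorne1977, II Cor. 5.5 and Prop. 5.6 (p. 113)] [cite: StacksProject, Tag 01I7] -/
theorem isIso_of_app_bijective_of_cover (hM : IsAffineLocalizing M) (hN : IsAffineLocalizing N) {ι : Type*}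
    (V : ι → X.Opens) (hV : ∀ i, IsAffineOpen (V i)) (hcov : ⨆ i, V i = ⊤)
    (hbij : ∀ i, Function.Bijective (φ.app (V i))) : IsIso φ :=
  haveI := mono_of_app_injective_of_cover φ hM hN V hV hcov fun i => (hbij i).1
  haveI := epi_of_app_surjective_of_cover φ hN V hV hcov fun i => (hbij i).2
  isIso_of_mono_of_epi φ

end Literature.AlgebraicGeometry.Modules

end
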